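import Mathlib
import Summits.Ventures.PercRepro2.BHKEvents
import Summits.Ventures.PercRepro2.OrderPreservation

/-!
# A one-cluster three-point inequality: the same-cluster sibling of the (B)-term (blind cell
PercRepro2, p5 g27; `proofs/P5-OEDGE.md` §35)

For the open cluster `C = C(s)` of a vertex `s` under the product measure (no conditioning) and three
vertices `o, v, y`, with `1_x = 1{x ∈ C}` and `Cov` the unconditioned covariance,

  **`Cov(1_o·1_v, 1_y) ≤ Cov(1_o, 1_y) + P(o ∈ C)·Cov(1_v, 1_y)`**   (`cov_mul_le_cov_add_prob_mul_cov`),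

equivalently `0 ≤ Cov(1_o·(1 − 1_v) + P(o ∈ C)·1_v, 1_y)`: the «switch» `1_o(1 − 1_v) + P(o)1_v` (the
indicator of `o` while `v ∉ C`, its mean once `v ∈ C`) is still positively correlated with every
cluster membership `1_y`.  In cleared masses (`P(X) := prob p X`, `O = {s ↔ o}` etc.)

  `T′ := [P(O∩Y) − P(O)P(Y)] + P(O)·[P(V∩Y) − P(V)P(Y)] − [P(O∩V∩Y) − P(O∩V)P(Y)] ≥ 0`.

Proof (the method of `LeafHalfCross.crossB_nonneg`, one cluster instead of two): the exact identity

  `(1 − P(V))·T′ = [P(Vᶜ)·P(O∩Y∩Vᶜ) − P(O∩Vᶜ)·P(Y∩Vᶜ)] + Cov(1_o, 1_v)·Cov(1_v, 1_y)`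

(`one_sub_prob_mul_T'_eq`), whose first bracket is the BHK06 Theorem 1.2 slack for the cluster of `s`
conditioned on the avoidance `s ↮ v` (`bhk_same_cluster_events`, `t := v`) and whose second term is a
product of two Harris covariances; on the corner `P(V) = 1` every `Vᶜ`-mass vanishes and `T′ = 0`.

Why it is here (paper-level, `proofs/P5-OEDGE.md` §35 — not formalised): in a two-sided graph (`b` on
the `a₁`-side, `o, v` on the `a₂`-side, bridges `(x_i, y_i)` of strength `ε_i`) the seat's first-order
expansion of the row candidate (G2) = (A) + (B) of (LEAF-½) reads `Σ_i ε_i·Cov_A(b, x_i)·T_i + O(ε²)`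
with `T_i = T′(a₂; o, v, y_i) + P(v ∈ C, o ↔ y_i, y_i ∉ C)`, so this theorem is what makes (G2)
nonnegative to first order there, while (AA0) is not (`AA0Witness.lean`).  Nothing here claims (G2).
-/

namespace Summit.Ventures.PercRepro2

namespace ClusterThreePoint

variable {V : Type*} {E : Type*} [Fintype E] [DecidableEq E] [Fintype V] [DecidableEq V]
  {R : Type*} [Field R] [LinearOrder R] [IsStrictOrderedRing R]

variable (p : E → R) (ends : E → Sym2 V)

/-- **The cleared three-point quantity** `T′(s; o, v, y)`:
`[P(O∩Y) − P(O)P(Y)] + P(O)·[P(V∩Y) − P(V)P(Y)] − [P(O∩V∩Y) − P(O∩V)P(Y)]`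
(`= Cov(1_o, 1_y) + P(o ∈ C)·Cov(1_v, 1_y) − Cov(1_o 1_v, 1_y)`). -/
noncomputable def T' (s o v y : V) : R :=
  (prob p (connEvent ends s o ∩ connEvent ends s y) -
      prob p (connEvent ends s o) * prob p (connEvent ends s y)) +
    prob p (connEvent ends s o) *
      (prob p (connEvent ends s v ∩ connEvent ends s y) -
        prob p (connEvent ends s v) * prob p (connEvent ends s y)) -
    (prob p (connEvent ends s o ∩ connEvent ends s v ∩ connEvent ends s y) -
      prob p (connEvent ends s o ∩ connEvent ends s v) * prob p (connEvent ends s y))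

omit [Fintype V] [DecidableEq V] [LinearOrder R] [IsStrictOrderedRing R] in
/-- **The exact identity behind `T′`**:
`(1 − P(V))·T′ = [P(Vᶜ)·P(O∩Y∩Vᶜ) − P(O∩Vᶜ)·P(Y∩Vᶜ)] + Cov(1_o, 1_v)·Cov(1_v, 1_y)`
(the `Vᶜ`-masses written through `prob_inter_add_prob_inter_compl`). -/
theorem one_sub_prob_mul_T'_eq (s o v y : V) :
    (1 - prob p (connEvent ends s v)) * T' p ends s o v y =
      (prob p (connEvent ends s v)ᶜ *
          prob p (connEvent ends s o ∩ connEvent ends s y ∩ (connEvent ends s v)ᶜ) -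
        prob p (connEvent ends s o ∩ (connEvent ends s v)ᶜ) *
          prob p (connEvent ends s y ∩ (connEvent ends s v)ᶜ)) +
      (prob p (connEvent ends s o ∩ connEvent ends s v) -
          prob p (connEvent ends s o) * prob p (connEvent ends s v)) *
        (prob p (connEvent ends s v ∩ connEvent ends s y) -
          prob p (connEvent ends s v) * prob p (connEvent ends s y)) := by
  have hO := prob_inter_add_prob_inter_compl p (connEvent ends s o) (connEvent ends s v)
  have hY := prob_inter_add_prob_inter_compl p (connEvent ends s y) (connEvent ends s v)
  have hOY := prob_inter_add_prob_inter_compl p (connEvent ends s o ∩ connEvent ends s y)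
    (connEvent ends s v)
  have hc := prob_compl p (connEvent ends s v)
  have hVY : prob p (connEvent ends s v ∩ connEvent ends s y) =
      prob p (connEvent ends s y ∩ connEvent ends s v) := by rw [Set.inter_comm]
  have hOVY : prob p (connEvent ends s o ∩ connEvent ends s v ∩ connEvent ends s y) =
      prob p (connEvent ends s o ∩ connEvent ends s y ∩ connEvent ends s v) := by
    rw [Set.inter_right_comm]
  have ha' : prob p (connEvent ends s o ∩ (connEvent ends s v)ᶜ) =
      prob p (connEvent ends s o) - prob p (connEvent ends s o ∩ connEvent ends s v) := by
    linear_combination hO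
  have hb' : prob p (connEvent ends s y ∩ (connEvent ends s v)ᶜ) =
      prob p (connEvent ends s y) - prob p (connEvent ends s y ∩ connEvent ends s v) := by
    linear_combination hY
  have hc' : prob p (connEvent ends s o ∩ connEvent ends s y ∩ (connEvent ends s v)ᶜ) =
      prob p (connEvent ends s o ∩ connEvent ends s y) -
        prob p (connEvent ends s o ∩ connEvent ends s y ∩ connEvent ends s v) := by
    linear_combination hOY
  unfold T'
  rw [hVY, hOVY, hc, ha', hb', hc']
  ring

/-- **BHK06 Theorem 1.2 for the cluster of `s` avoiding `v`, two connection events**: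
`P(O ∩ Vᶜ)·P(Y ∩ Vᶜ) ≤ P(O ∩ Y ∩ Vᶜ)·P(Vᶜ)`. -/
theorem same_cluster_avoid_v (hp : IsProbVec p) (s o v y : V) :
    prob p (connEvent ends s o ∩ (connEvent ends s v)ᶜ) *
        prob p (connEvent ends s y ∩ (connEvent ends s v)ᶜ) ≤
      prob p (connEvent ends s o ∩ connEvent ends s y ∩ (connEvent ends s v)ᶜ) *
        prob p (connEvent ends s v)ᶜ := by
  have h := bhk_same_cluster_events p hp ends s v (isUpperSet_mem_setOf o) (isUpperSet_mem_setOf y)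
  rwa [← connEvent_eq_clusterInEvent ends s o, ← connEvent_eq_clusterInEvent ends s y] at h

/-- **The one-cluster three-point inequality**: `0 ≤ T′(s; o, v, y)`, i.e.
`Cov(1_o 1_v, 1_y) ≤ Cov(1_o, 1_y) + P(o ∈ C)·Cov(1_v, 1_y)` for the cluster `C` of `s`. -/
theorem T'_nonneg (hp : IsProbVec p) (s o v y : V) : 0 ≤ T' p ends s o v y := by
  have hid := one_sub_prob_mul_T'_eq p ends s o v y
  have hbhk := same_cluster_avoid_v p ends hp s o v y
  have hov := prob_mul_prob_le_prob_inter hp (isUpperSet_connEvent ends s o)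
    (isUpperSet_connEvent ends s v)
  have hvy := prob_mul_prob_le_prob_inter hp (isUpperSet_connEvent ends s v)
    (isUpperSet_connEvent ends s y)
  have hc := prob_compl p (connEvent ends s v)
  have hv1 := prob_le_one hp (connEvent ends s v)
  have hcov : 0 ≤ (prob p (connEvent ends s o ∩ connEvent ends s v) -
        prob p (connEvent ends s o) * prob p (connEvent ends s v)) *
      (prob p (connEvent ends s v ∩ connEvent ends s y) -
        prob p (connEvent ends s v) * prob p (connEvent ends s y)) :=
    mul_nonneg (sub_nonneg.2 hov) (sub_nonneg.2 hvy)
  have hD : 0 ≤ (1 - prob p (connEvent ends s v)) * T' p ends s o v y := by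
    rw [hid]
    linarith
  rcases (sub_nonneg.2 hv1).lt_or_eq with hpos | hzero
  · exact le_of_mul_le_mul_left (by rw [mul_zero]; exact hD) hpos
  · -- the corner `P(V) = 1`: every `Vᶜ`-mass vanishes and `T′ = 0`
    have hVc : prob p (connEvent ends s v)ᶜ = 0 := by rw [hc]; linarith
    have hOc : prob p (connEvent ends s o ∩ (connEvent ends s v)ᶜ) = 0 :=
      le_antisymm (by
        calc prob p (connEvent ends s o ∩ (connEvent ends s v)ᶜ)
            ≤ prob p (connEvent ends s v)ᶜ := prob_inter_le_right hp _ _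
          _ = 0 := hVc) (prob_nonneg hp _)
    have hYc : prob p (connEvent ends s y ∩ (connEvent ends s v)ᶜ) = 0 :=
      le_antisymm (by
        calc prob p (connEvent ends s y ∩ (connEvent ends s v)ᶜ)
            ≤ prob p (connEvent ends s v)ᶜ := prob_inter_le_right hp _ _
          _ = 0 := hVc) (prob_nonneg hp _)
    have hOYc : prob p (connEvent ends s o ∩ connEvent ends s y ∩ (connEvent ends s v)ᶜ) = 0 :=
      le_antisymm (by
        calc prob p (connEvent ends s o ∩ connEvent ends s y ∩ (connEvent ends s v)ᶜ)
            ≤ prob p (connEvent ends s v)ᶜ := prob_inter_le_right hp _ _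
          _ = 0 := hVc) (prob_nonneg hp _)
    have hO := prob_inter_add_prob_inter_compl p (connEvent ends s o) (connEvent ends s v)
    have hY := prob_inter_add_prob_inter_compl p (connEvent ends s y) (connEvent ends s v)
    have hOY := prob_inter_add_prob_inter_compl p (connEvent ends s o ∩ connEvent ends s y)
      (connEvent ends s v)
    have hVY : prob p (connEvent ends s v ∩ connEvent ends s y) =
        prob p (connEvent ends s y ∩ connEvent ends s v) := by rw [Set.inter_comm]
    have hOVY : prob p (connEvent ends s o ∩ connEvent ends s v ∩ connEvent ends s y) =
        prob p (connEvent ends s o ∩ connEvent ends s y ∩ connEvent ends s v) := by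
      rw [Set.inter_right_comm]
    have hv : prob p (connEvent ends s v) = 1 := by linarith
    unfold T'
    rw [hVY, hOVY, hOc, add_zero] at *
    rw [hYc, add_zero] at hY
    rw [hOYc, add_zero] at hOY
    rw [hO, hY, hOY, hv]
    ring_nf
    exact le_refl _

/-- **The covariance form**: `Cov(1_o 1_v, 1_y) ≤ Cov(1_o, 1_y) + P(o ∈ C)·Cov(1_v, 1_y)`. -/
theorem cov_mul_le_cov_add_prob_mul_cov (hp : IsProbVec p) (s o v y : V) :
    prob p (connEvent ends s o ∩ connEvent ends s v ∩ connEvent ends s y) -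
        prob p (connEvent ends s o ∩ connEvent ends s v) * prob p (connEvent ends s y) ≤
      (prob p (connEvent ends s o ∩ connEvent ends s y) -
          prob p (connEvent ends s o) * prob p (connEvent ends s y)) +
        prob p (connEvent ends s o) *
          (prob p (connEvent ends s v ∩ connEvent ends s y) -
            prob p (connEvent ends s v) * prob p (connEvent ends s y)) := by
  have h := T'_nonneg p ends hp s o v y
  unfold T' at h
  linarith

end ClusterThreePoint

end Summit.Ventures.PercRepro2
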